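import Mathlib

/-!
# Hadamard 668 census, family F12 — the 2-(667,333,166) incidence matrix modulo 167: Gram identities and the lifting lemma

Framing: lottery ticket; floor = certified bounds/negative ranges.

Cell pub-namedobj (venture DiscreteObjects), target (H), hadamard gen 8.  For a `0/1` incidence function `N : P → B → ℤ` with
column sums `333` and column inner products `166` (dually rows), reduced modulo the prime `167 = 333 - 166 = n` (the order
of the design):
* `gram_mod167` — every entry of `N̄ᵀ N̄` (and of `N̄ N̄ᵀ`) is `-1` in `ZMod 167` (`333 ≡ 166 ≡ -1`), so `N̄ᵀ(N̄ w) = -(Σ w)·𝟙`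
  (`transpose_mulVec_mulVec_mod167`);
* `lift_mod167` — **LIFTING LEMMA**: if `N̄ v = 0` over `ZMod 167` then `v = N̄ᵀ w + s·𝟙` for some `w`, `s`.  Proof over `ℤ`:
  lift `v` to `ṽ`, write `N ṽ = 167 w̃`; then `Nᵀ N ṽ = 167 ṽ + 166 (Σ ṽ) 𝟙 = 167 Nᵀ w̃` forces `167 ∣ Σ ṽ` and
  `ṽ = Nᵀ w̃ - 166 (Σ ṽ / 167) 𝟙`.
This is the characteristic-zero input (`ker N̄ ⊆ im N̄ᵀ + ⟨𝟙⟩`) of the kernel proof of Lander's parity theorem for `p = 29`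
(`PrimeOrder29Parity`).  Ours, not literature; no `sorry`.
-/

open Finset BigOperators

namespace Summit.Ventures.DiscreteObjects.Hadamard

variable {P B : Type*} [Fintype P] [Fintype B] [DecidableEq B]

omit [Fintype P] [Fintype B] [DecidableEq B] in
/-- a `0/1` value is idempotent -/
lemma mul_self_of_zero_or_one {a : ℤ} (h : a = 0 ∨ a = 1) : a * a = a := by
  rcases h with rfl | rfl <;> norm_num

omit [Fintype B] in
/-- column Gram matrix over `ℤ`: `Σ_x N x y · N x y' = 333` or `166` -/
lemma gram_col_int (N : P → B → ℤ) (h01 : ∀ x y, N x y = 0 ∨ N x y = 1) (hcol : ∀ y, ∑ x, N x y = 333)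
    (hcpair : ∀ y y', y ≠ y' → ∑ x, N x y * N x y' = 166) (y y' : B) :
    ∑ x, N x y * N x y' = if y = y' then 333 else 166 := by
  split_ifs with h
  · subst h
    rw [Finset.sum_congr rfl fun x _ => mul_self_of_zero_or_one (h01 x y)]
    exact hcol y
  · exact hcpair y y' h

omit [Fintype B] in
/-- **Gram modulo 167**: every entry of `N̄ᵀ N̄` is `-1` in `ZMod 167` -/
theorem gram_mod167 (N : P → B → ℤ) (h01 : ∀ x y, N x y = 0 ∨ N x y = 1) (hcol : ∀ y, ∑ x, N x y = 333)
    (hcpair : ∀ y y', y ≠ y' → ∑ x, N x y * N x y' = 166) (y y' : B) :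
    ∑ x, (N x y : ZMod 167) * (N x y' : ZMod 167) = -1 := by
  have e := congrArg (Int.cast : ℤ → ZMod 167) (gram_col_int N h01 hcol hcpair y y')
  push_cast at e
  rw [e]
  split_ifs <;> decide

/-- `N̄ᵀ (N̄ w) = -(Σ w) · 𝟙` over `ZMod 167` -/
theorem transpose_mulVec_mulVec_mod167 (N : P → B → ℤ) (h01 : ∀ x y, N x y = 0 ∨ N x y = 1)
    (hcol : ∀ y, ∑ x, N x y = 333) (hcpair : ∀ y y', y ≠ y' → ∑ x, N x y * N x y' = 166)
    (w : B → ZMod 167) (y : B) :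
    ∑ x, (N x y : ZMod 167) * ∑ y', (N x y' : ZMod 167) * w y' = -∑ y', w y' := by
  calc ∑ x, (N x y : ZMod 167) * ∑ y', (N x y' : ZMod 167) * w y'
      = ∑ y', (∑ x, (N x y : ZMod 167) * (N x y' : ZMod 167)) * w y' := by
        simp_rw [Finset.mul_sum, Finset.sum_mul, mul_assoc]
        exact Finset.sum_comm
    _ = ∑ y', (-1) * w y' := Finset.sum_congr rfl fun y' _ => by rw [gram_mod167 N h01 hcol hcpair]
    _ = -∑ y', w y' := by simp

/-- **Lifting lemma**: over `ZMod 167`, `N̄ v = 0` implies `v = N̄ᵀ w + s · 𝟙`. -/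
theorem lift_mod167 (N : P → B → ℤ) (h01 : ∀ x y, N x y = 0 ∨ N x y = 1) (hcol : ∀ y, ∑ x, N x y = 333)
    (hcpair : ∀ y y', y ≠ y' → ∑ x, N x y * N x y' = 166)
    (v : B → ZMod 167) (hv : ∀ x, ∑ y, (N x y : ZMod 167) * v y = 0) :
    ∃ (w : P → ZMod 167) (s : ZMod 167), ∀ y, v y = (∑ x, (N x y : ZMod 167) * w x) + s := by
  -- integer lift of v
  let vz : B → ℤ := fun y => ((v y).val : ℤ)
  have hvz : ∀ y, ((vz y : ℤ) : ZMod 167) = v y := fun y => by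
    simp only [vz, Int.cast_natCast, ZMod.natCast_zmod_val]
  -- N vz ≡ 0 (mod 167)
  have hdvd : ∀ x, (167 : ℤ) ∣ ∑ y, N x y * vz y := by
    intro x
    have h0 : ((∑ y, N x y * vz y : ℤ) : ZMod 167) = 0 := by
      push_cast
      simp_rw [hvz]
      exact hv x
    exact_mod_cast (ZMod.intCast_zmod_eq_zero_iff_dvd _ 167).mp h0
  choose wz hwz using hdvd
  set S : ℤ := ∑ y, vz y with hS
  -- Nᵀ N vz = 167 vz + 166 S
  have key : ∀ y, 167 * ∑ x, N x y * wz x = 167 * vz y + 166 * S := by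
    intro y
    calc 167 * ∑ x, N x y * wz x = ∑ x, N x y * (167 * wz x) := by
          rw [Finset.mul_sum]
          exact Finset.sum_congr rfl fun x _ => by ring
      _ = ∑ x, N x y * ∑ y', N x y' * vz y' := by simp_rw [← hwz]
      _ = ∑ y', (∑ x, N x y * N x y') * vz y' := by
          simp_rw [Finset.mul_sum, Finset.sum_mul, mul_assoc]
          exact Finset.sum_comm
      _ = ∑ y', (166 * vz y' + if y = y' then 167 * vz y' else 0) := by
          refine Finset.sum_congr rfl fun y' _ => ?_
          rw [gram_col_int N h01 hcol hcpair y y']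
          split_ifs <;> ring
      _ = 167 * vz y + 166 * S := by
          rw [Finset.sum_add_distrib, Finset.sum_ite_eq, if_pos (Finset.mem_univ y), ← Finset.mul_sum, hS]
          ring
  -- 167 ∣ S
  have hSdvd : (167 : ℤ) ∣ S := by
    rcases isEmpty_or_nonempty B with hB | ⟨⟨y₀⟩⟩
    · rw [hS, Finset.univ_eq_empty, Finset.sum_empty]
      exact dvd_zero _
    · have h1 : (167 : ℤ) ∣ 166 * S := ⟨∑ x, N x y₀ * wz x - vz y₀, by linarith [key y₀]⟩
      exact Int.dvd_of_dvd_mul_right_of_gcd_one h1 (by norm_num)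
  obtain ⟨sz, hsz⟩ := hSdvd
  -- vz y = Σ_x N x y wz x - 166 sz
  have hsol : ∀ y, vz y = ∑ x, N x y * wz x + (-(166 * sz)) := by
    intro y
    have e := key y
    rw [hsz] at e
    have : (167 : ℤ) * vz y = 167 * (∑ x, N x y * wz x + (-(166 * sz))) := by linarith
    exact mul_left_cancel₀ (by norm_num) this
  refine ⟨fun x => (wz x : ZMod 167), ((-(166 * sz) : ℤ) : ZMod 167), fun y => ?_⟩
  rw [← hvz y, hsol y]
  push_cast
  rfl

end Summit.Ventures.DiscreteObjects.Hadamard
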